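import Summits.Ventures.CertifiedManyBodySolver.Observables.StructureFactorsConnected
import Literature.MathematicalPhysics.QuantumLattice.HubbardModelParticleHoleProofs

/-!
# M3 (iii): the full-zone SUM RULES of the spin / charge structure factors on the `L × L` torus,
# and the certificate-free CEILINGS they give at every momentum and every momentum class

HONEST FRAMING: first certified bounds; not a superconductivity verdict; every number
certified or labelled float.  This file is exact kinematics (identities + positivity) for EVERY
vector `ψ` of the `L × L` Hubbard torus Fock space, every `L`; no Hubbard ground state enters.

Speedrun `mbsolver`, seat sr-mbsolver-m3-4 (stripe definitions; `run/shared/lean/speedrun/mbsolver/m3/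
stripe_defs.md` §5bis "kinematic range" column), on top of the stripe-rows seat's dictionary
(`Observables/StructureFactors*.lean`, sr-mbsolver-m3-7).

## What is proved (all `L`, all `ψ`, all momentum indices `k`, all finite sets `K` of them)

* `sum_blochPhase_momentum`: **`Σ_k e^{2πi k·r/L} = L² · [r = 0]`** — character orthogonality summed
  over the MOMENTUM index (the tree had the sum over sites, `sum_blochPhase_eq_zero`; the two agree
  because `k·r = r·k`, `torusDot_comm`).
* `sum_univ_spinStructureOp` / `sum_univ_densityStructureOp`: **`Σ_k 𝓢_s(k) = L² • W_0`**,
  **`Σ_k 𝓢_c(k) = L² • N_0`** (operator identities; `W_0 = Σ_x 𝐒_x·𝐒_x = (3/4) Σ_x m_x` by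
  `spinCorrSum_zero`, `N_0 = Σ_x n_x²`).
* `sum_univ_spinStructureFactor` / `sum_univ_densityStructureFactor`: the **full-zone sum rules**
  `Σ_k S_s(k; ψ) = Re ⟨ψ, W_0 ψ⟩` and `Σ_k S_c(k; ψ) = Re ⟨ψ, N_0 ψ⟩` (note: the per-site
  normalisation `1/L²` of `S(k; ψ)` cancels the `L²`; for a unit `N`-particle vector with total double
  occupancy `D` these are `(3/4)(N − 2D)` and `N + 2D` — that evaluation is NOT done here).
* `sum_spinStructureFactor_le` / `spinStructureFactor_le_expect_spinCorrSum_zero` (+ density twins):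
  the **certificate-free ceilings** `Σ_{k ∈ K} S_s(k; ψ) ≤ Re ⟨ψ, W_0 ψ⟩`, in particular
  `S_s(k; ψ) ≤ Re ⟨ψ, W_0 ψ⟩` for every single `k`, from the sum rule and `spinStructureFactor_nonneg`
  (every other term of the zone sum is `≥ 0`).  These are the "kinematic range" upper ends that a
  moment-relaxation window has to beat to be informative (stripe_defs.md §5bis; STRIPE-ROWS.md §9 asks
  for exactly these ceilings "for other q"); they are NOT sharp (the Hilbert-space-sharp ceiling of
  `S_s(π,π)` on the `4 × 4`, `N = 14` torus is `63/16`, a finite computation not attempted here).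
* Evaluated forms: `siteDensity_mul_self` (`n_x² = n_x + 2 n_{x↑}n_{x↓}`), `densityCorrSum_zero`
  (`N_0 = Σ_x n_x + 2 Σ_x n_{x↑}n_{x↓}`), `sum_localMoment_eq`; hence
  `sum_univ_spinStructureFactor_eq_density_docc`: `Σ_k S_s(k; ψ) = (3/4)(𝒩 − 2𝒟)` and
  `sum_univ_densityStructureFactor_eq_density_docc`: `Σ_k S_c(k; ψ) = 𝒩 + 2𝒟` with
  `𝒩 = Re ⟨ψ, Σ_x n_x ψ⟩`, `𝒟 = Re ⟨ψ, Σ_x n_{x↑}n_{x↓} ψ⟩` (the quantity of the cell's `docc` rows).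
* `N`-particle vectors (`IsNParticle N ψ`, `‖ψ‖ = 1`; `N̂ψ = Nψ` is the tree's
  `QuantumLattice.totalNumber_mulVec_of_isNParticle`): `sum_siteDensity_eq_totalNumber`, `densityStructureOp_zero` (`𝓢_c(0) = N̂²`),
  `densityStructureFactor_zero_of_isNParticle` (Bragg peak `S_c(0; ψ) = N²/L²`), and the two
  ceilings actually used as the "kinematic range" of the `4 × 4`, `N = 14` windows:
  `sum_spinStructureFactor_le_of_isNParticle`: **`Σ_{k ∈ K} S_s(k; ψ) ≤ (3/4)(N − 2𝒟)`** (any `K`),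
  `sum_densityStructureFactor_le_of_isNParticle`: **`Σ_{k ∈ K} S_c(k; ψ) ≤ N + 2𝒟 − N²/L²`**
  (`0 ∉ K`).  With a certified two-sided docc window `𝒟 ∈ [D_lo, D_up]` these are explicit numbers
  (`4 × 4`, `N = 14`, `t′ = 0`: `Σ_{k} S_s ≤ (3/4)(14 − 2·0.3583) = 9.96`, `Σ_{k≠0} S_c ≤ 14 + 2·1.0367 −
  12.25 = 3.82`, per site after dividing a class sum by the class size; float evaluation, the
  inequalities themselves are exact).

References: Hirsch, PRB 31 (1985) 4403, eq. (4.7) (definitions); the sum rule is the `r = 0` Fourier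
coefficient (Wiener–Khinchin on the finite torus), folklore.
-/

noncomputable section

namespace Summit.Ventures.CertifiedManyBodySolver.Observables

open Matrix Literature.MathematicalPhysics.QuantumLattice Literature.Probability.LatticeModels
open Literature.MathematicalPhysics.QuantumLattice.HubbardWave0
open Literature.MathematicalPhysics.QuantumLattice.FermionTorus
open scoped BigOperators ComplexConjugate

section SumRule

variable (L : ℕ) [NeZero L]

/-! ### Character orthogonality over the momentum index -/

omit [NeZero L] in
/-- `k·r = r·k`. -/
theorem torusDot_comm (k r : TorusSite 2 L) : torusDot L k r = torusDot L r k := by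
  simp only [torusDot, mul_comm]

/-- `e^{2πi k·r/L}` is symmetric in `(k, r)`. -/
theorem blochPhase_comm (k r : TorusSite 2 L) : blochPhase L k r = blochPhase L r k := by
  rw [blochPhase, blochPhase, torusDot_comm]

/-- **`Σ_k e^{2πi k·r/L} = L² · [r = 0]`** (character orthogonality, summed over momenta). -/
theorem sum_blochPhase_momentum (r : TorusSite 2 L) :
    ∑ k : TorusSite 2 L, blochPhase L k r = if r = 0 then ((L : ℂ) ^ 2) else 0 := by
  split_ifs with hr
  · subst hr
    simp_rw [blochPhase_comm L _ (0 : TorusSite 2 L)]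
    exact sum_blochPhase_zero_left L
  · simp_rw [blochPhase_comm L _ r]
    exact sum_blochPhase_eq_zero L hr

/-- `Σ_k e^{-2πi k·r/L} = L² · [r = 0]`. -/
theorem sum_star_blochPhase_momentum (r : TorusSite 2 L) :
    ∑ k : TorusSite 2 L, star (blochPhase L k r) = if r = 0 then ((L : ℂ) ^ 2) else 0 := by
  rw [← star_sum, sum_blochPhase_momentum]
  split_ifs <;> simp

/-! ### Operator sum rules `Σ_k 𝓢(k) = L² • (r = 0 correlator)` -/

/-- **`Σ_k 𝓢_s(k) = L² • W_0`.** -/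
theorem sum_univ_spinStructureOp :
    ∑ k : TorusSite 2 L, spinStructureOp L k = ((L : ℂ) ^ 2) • spinCorrSum L 0 := by
  simp_rw [spinStructureOp_eq_sum_smul_spinCorrSum]
  rw [Finset.sum_comm]
  simp_rw [← Finset.sum_smul, sum_star_blochPhase_momentum, ite_smul, zero_smul]
  rw [Finset.sum_ite_eq' Finset.univ (0 : TorusSite 2 L)]
  simp

/-- **`Σ_k 𝓢_c(k) = L² • N_0`.** -/
theorem sum_univ_densityStructureOp :
    ∑ k : TorusSite 2 L, densityStructureOp L k = ((L : ℂ) ^ 2) • densityCorrSum L 0 := by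
  simp_rw [densityStructureOp_eq_sum_smul_densityCorrSum]
  rw [Finset.sum_comm]
  simp_rw [← Finset.sum_smul, sum_star_blochPhase_momentum, ite_smul, zero_smul]
  rw [Finset.sum_ite_eq' Finset.univ (0 : TorusSite 2 L)]
  simp

/-! ### Full-zone sum rules for the per-site functionals -/

/-- `Re(L² z) / L² = Re z`. -/
private theorem re_sq_mul_div_sq (z : ℂ) :
    (((L : ℂ) ^ 2) * z).re / (L : ℝ) ^ 2 = z.re := by
  have hL : (L : ℝ) ≠ 0 := Nat.cast_ne_zero.mpr (NeZero.ne L)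
  have h1 : (((L : ℂ) ^ 2) * z).re = (L : ℝ) ^ 2 * z.re := by
    have : ((L : ℂ) ^ 2) = (((L : ℝ) ^ 2 : ℝ) : ℂ) := by push_cast; rfl
    rw [this, Complex.re_ofReal_mul]
  rw [h1]
  field_simp

/-- **Full-zone spin sum rule: `Σ_k S_s(k; ψ) = Re ⟨ψ, W_0 ψ⟩`** (`= (3/4) Re ⟨ψ, Σ_x m_x ψ⟩`). -/
theorem sum_univ_spinStructureFactor (ψ : Fock (Orb (FermionTorus 2 L))) :
    ∑ k : TorusSite 2 L, spinStructureFactor L k ψ = (expect (spinCorrSum L 0) ψ).re := by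
  unfold spinStructureFactor
  rw [← Finset.sum_div, ← Complex.re_sum, ← expect_sum, sum_univ_spinStructureOp, expect_smul]
  exact re_sq_mul_div_sq L _

/-- **Full-zone charge sum rule: `Σ_k S_c(k; ψ) = Re ⟨ψ, N_0 ψ⟩`** (`N_0 = Σ_x n_x²`). -/
theorem sum_univ_densityStructureFactor (ψ : Fock (Orb (FermionTorus 2 L))) :
    ∑ k : TorusSite 2 L, densityStructureFactor L k ψ = (expect (densityCorrSum L 0) ψ).re := by
  unfold densityStructureFactor
  rw [← Finset.sum_div, ← Complex.re_sum, ← expect_sum, sum_univ_densityStructureOp, expect_smul]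
  exact re_sq_mul_div_sq L _

/-- The spin sum rule in local-moment form: `Σ_k S_s(k; ψ) = (3/4) · Re ⟨ψ, (Σ_x m_x) ψ⟩`. -/
theorem sum_univ_spinStructureFactor_eq_localMoment (ψ : Fock (Orb (FermionTorus 2 L))) :
    ∑ k : TorusSite 2 L, spinStructureFactor L k ψ =
      (3 / 4 : ℝ) * (expect (∑ x : TorusSite 2 L, FermionSpinMoment.localMoment (ofTorusSite x)) ψ).re := by
  rw [sum_univ_spinStructureFactor, spinCorrSum_zero, expect_smul]
  have : (3 / 4 : ℂ) = ((3 / 4 : ℝ) : ℂ) := by push_cast; rfl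
  rw [this, Complex.re_ofReal_mul]

/-! ### Certificate-free ceilings from positivity -/

/-- **`Σ_{k ∈ K} S_s(k; ψ) ≤ Re ⟨ψ, W_0 ψ⟩`** for every finite set of momenta `K`. -/
theorem sum_spinStructureFactor_le (K : Finset (TorusSite 2 L)) (ψ : Fock (Orb (FermionTorus 2 L))) :
    ∑ k ∈ K, spinStructureFactor L k ψ ≤ (expect (spinCorrSum L 0) ψ).re := by
  rw [← sum_univ_spinStructureFactor]
  exact Finset.sum_le_sum_of_subset_of_nonneg (Finset.subset_univ K)
    (fun k _ _ => spinStructureFactor_nonneg L k ψ)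

/-- **`S_s(k; ψ) ≤ Re ⟨ψ, W_0 ψ⟩`** for every single momentum. -/
theorem spinStructureFactor_le_expect_spinCorrSum_zero (k : TorusSite 2 L)
    (ψ : Fock (Orb (FermionTorus 2 L))) :
    spinStructureFactor L k ψ ≤ (expect (spinCorrSum L 0) ψ).re := by
  have h := sum_spinStructureFactor_le L {k} ψ
  simpa using h

/-- **`Σ_{k ∈ K} S_c(k; ψ) ≤ Re ⟨ψ, N_0 ψ⟩`** for every finite set of momenta `K`. -/
theorem sum_densityStructureFactor_le (K : Finset (TorusSite 2 L)) (ψ : Fock (Orb (FermionTorus 2 L))) :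
    ∑ k ∈ K, densityStructureFactor L k ψ ≤ (expect (densityCorrSum L 0) ψ).re := by
  rw [← sum_univ_densityStructureFactor]
  exact Finset.sum_le_sum_of_subset_of_nonneg (Finset.subset_univ K)
    (fun k _ _ => densityStructureFactor_nonneg L k ψ)

/-- **`Σ_{k ∈ K} S_c(k; ψ) ≤ Re ⟨ψ, N_0 ψ⟩ − S_c(0; ψ)`** for every `K` avoiding `k = 0` (the Bragg
peak `S_c(0; ψ) = N²/L²` of an `N`-particle vector is subtracted; useful form for `q ≠ 0` classes). -/
theorem sum_densityStructureFactor_le_of_zero_not_mem (K : Finset (TorusSite 2 L)) (hK : (0 : TorusSite 2 L) ∉ K)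
    (ψ : Fock (Orb (FermionTorus 2 L))) :
    ∑ k ∈ K, densityStructureFactor L k ψ ≤
      (expect (densityCorrSum L 0) ψ).re - densityStructureFactor L 0 ψ := by
  rw [← sum_univ_densityStructureFactor, ← Finset.sum_erase_eq_sub (Finset.mem_univ _)]
  exact Finset.sum_le_sum_of_subset_of_nonneg (fun k hk => Finset.mem_erase.mpr ⟨fun h => hK (h ▸ hk), Finset.mem_univ k⟩)
    (fun k _ _ => densityStructureFactor_nonneg L k ψ)

/-- Same for the spin channel: **`Σ_{k ∈ K} S_s(k; ψ) ≤ Re ⟨ψ, W_0 ψ⟩ − S_s(0; ψ)`** when `0 ∉ K`. -/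
theorem sum_spinStructureFactor_le_of_zero_not_mem (K : Finset (TorusSite 2 L)) (hK : (0 : TorusSite 2 L) ∉ K)
    (ψ : Fock (Orb (FermionTorus 2 L))) :
    ∑ k ∈ K, spinStructureFactor L k ψ ≤
      (expect (spinCorrSum L 0) ψ).re - spinStructureFactor L 0 ψ := by
  rw [← sum_univ_spinStructureFactor, ← Finset.sum_erase_eq_sub (Finset.mem_univ _)]
  exact Finset.sum_le_sum_of_subset_of_nonneg (fun k hk => Finset.mem_erase.mpr ⟨fun h => hK (h ▸ hk), Finset.mem_univ k⟩)
    (fun k _ _ => spinStructureFactor_nonneg L k ψ)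

/-! ### Evaluated forms: `Σ_k S_s = (3/4)(N − 2D)`, `Σ_k S_c = N + 2D` in expectation -/

/-- `Σ_x m_x = Σ_x n_x − 2 Σ_x n_{x↑} n_{x↓}` on the torus (definition of the local moment). -/
theorem sum_localMoment_eq :
    ∑ x : TorusSite 2 L, FermionSpinMoment.localMoment (ofTorusSite x) =
      ∑ x : TorusSite 2 L, siteDensity (ofTorusSite x) +
        (-2 : ℂ) • ∑ x : TorusSite 2 L, (numberOp (ofTorusSite x) 0 * numberOp (ofTorusSite x) 1 :
          Matrix (Finset (Orb (FermionTorus 2 L))) (Finset (Orb (FermionTorus 2 L))) ℂ) := by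
  rw [Finset.smul_sum, ← Finset.sum_add_distrib]
  refine Finset.sum_congr rfl fun x _ => ?_
  rw [FermionSpinMoment.localMoment, siteDensity_def, sub_eq_add_neg, neg_smul]

/-- **`Σ_k S_s(k; ψ) = (3/4)(𝒩 − 2𝒟)`** where `𝒩 = Re ⟨ψ, Σ_x n_x ψ⟩` and `𝒟 = Re ⟨ψ, Σ_x n_{x↑}n_{x↓} ψ⟩`
(for a unit `N`-particle vector `𝒩 = N`; `𝒟` = total double occupancy, the quantity the cell's
`docc` rows certify). -/
theorem sum_univ_spinStructureFactor_eq_density_docc (ψ : Fock (Orb (FermionTorus 2 L))) :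
    ∑ k : TorusSite 2 L, spinStructureFactor L k ψ =
      (3 / 4 : ℝ) * ((expect (∑ x : TorusSite 2 L, siteDensity (ofTorusSite x)) ψ).re -
        2 * (expect (∑ x : TorusSite 2 L, (numberOp (ofTorusSite x) 0 * numberOp (ofTorusSite x) 1 :
          Matrix (Finset (Orb (FermionTorus 2 L))) (Finset (Orb (FermionTorus 2 L))) ℂ)) ψ).re) := by
  rw [sum_univ_spinStructureFactor_eq_localMoment, sum_localMoment_eq, expect_add, expect_smul,
    Complex.add_re]
  have : (-2 : ℂ) = ((-2 : ℝ) : ℂ) := by push_cast; rfl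
  rw [this, Complex.re_ofReal_mul]
  ring

section SiteDensitySq

variable {Λ : Type*} [LinearOrder Λ] [Fintype Λ]

/-- **`n_x² = n_x + 2 n_{x↑} n_{x↓}`** (the two `n_{xσ}` are commuting projections). -/
theorem siteDensity_mul_self (x : Λ) :
    siteDensity x * siteDensity x =
      siteDensity x + (2 : ℂ) • (numberOp x 0 * numberOp x 1 : Matrix (Finset (Orb Λ)) (Finset (Orb Λ)) ℂ) := by
  rw [siteDensity_def, LiebThm1.numberOp_eq_diagonal, LiebThm1.numberOp_eq_diagonal, diagonal_add,
    diagonal_mul_diagonal, diagonal_mul_diagonal, ← diagonal_smul, diagonal_add]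
  congr 1
  funext s
  simp only [Pi.smul_apply, smul_eq_mul]
  split_ifs <;> norm_num

end SiteDensitySq

/-- `N_0 = Σ_x n_x² = Σ_x n_x + 2 Σ_x n_{x↑} n_{x↓}`. -/
theorem densityCorrSum_zero :
    densityCorrSum L 0 = ∑ x : TorusSite 2 L, siteDensity (ofTorusSite x) +
      (2 : ℂ) • ∑ x : TorusSite 2 L, (numberOp (ofTorusSite x) 0 * numberOp (ofTorusSite x) 1 :
          Matrix (Finset (Orb (FermionTorus 2 L))) (Finset (Orb (FermionTorus 2 L))) ℂ) := by
  rw [Finset.smul_sum, ← Finset.sum_add_distrib]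
  simp only [densityCorrSum, add_zero, siteDensity_mul_self]

/-- **`Σ_k S_c(k; ψ) = 𝒩 + 2𝒟`** (`𝒩 = Re ⟨ψ, Σ_x n_x ψ⟩`, `𝒟 = Re ⟨ψ, Σ_x n_{x↑}n_{x↓} ψ⟩`). -/
theorem sum_univ_densityStructureFactor_eq_density_docc (ψ : Fock (Orb (FermionTorus 2 L))) :
    ∑ k : TorusSite 2 L, densityStructureFactor L k ψ =
      (expect (∑ x : TorusSite 2 L, siteDensity (ofTorusSite x)) ψ).re +
        2 * (expect (∑ x : TorusSite 2 L, (numberOp (ofTorusSite x) 0 * numberOp (ofTorusSite x) 1 :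
          Matrix (Finset (Orb (FermionTorus 2 L))) (Finset (Orb (FermionTorus 2 L))) ℂ)) ψ).re := by
  rw [sum_univ_densityStructureFactor, densityCorrSum_zero, expect_add, expect_smul, Complex.add_re]
  have : (2 : ℂ) = ((2 : ℝ) : ℂ) := by push_cast; rfl
  rw [this, Complex.re_ofReal_mul]

/-- **Ceiling in `(𝒩, 𝒟)` form, spin channel: `Σ_{k ∈ K} S_s(k; ψ) ≤ (3/4)(𝒩 − 2𝒟)`** — with a
certified docc LOWER bound `𝒟 ≥ D_lo` this is the certificate-free range used in stripe_defs §5bis. -/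
theorem sum_spinStructureFactor_le_density_docc (K : Finset (TorusSite 2 L))
    (ψ : Fock (Orb (FermionTorus 2 L))) :
    ∑ k ∈ K, spinStructureFactor L k ψ ≤
      (3 / 4 : ℝ) * ((expect (∑ x : TorusSite 2 L, siteDensity (ofTorusSite x)) ψ).re -
        2 * (expect (∑ x : TorusSite 2 L, (numberOp (ofTorusSite x) 0 * numberOp (ofTorusSite x) 1 :
          Matrix (Finset (Orb (FermionTorus 2 L))) (Finset (Orb (FermionTorus 2 L))) ℂ)) ψ).re) := by
  rw [← sum_univ_spinStructureFactor_eq_density_docc]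
  exact Finset.sum_le_sum_of_subset_of_nonneg (Finset.subset_univ K)
    (fun k _ _ => spinStructureFactor_nonneg L k ψ)

/-- **Ceiling in `(𝒩, 𝒟)` form, charge channel, `0 ∉ K`: `Σ_{k ∈ K} S_c(k; ψ) ≤ 𝒩 + 2𝒟 − S_c(0; ψ)`.** -/
theorem sum_densityStructureFactor_le_density_docc (K : Finset (TorusSite 2 L)) (hK : (0 : TorusSite 2 L) ∉ K)
    (ψ : Fock (Orb (FermionTorus 2 L))) :
    ∑ k ∈ K, densityStructureFactor L k ψ ≤
      (expect (∑ x : TorusSite 2 L, siteDensity (ofTorusSite x)) ψ).re +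
        2 * (expect (∑ x : TorusSite 2 L, (numberOp (ofTorusSite x) 0 * numberOp (ofTorusSite x) 1 :
          Matrix (Finset (Orb (FermionTorus 2 L))) (Finset (Orb (FermionTorus 2 L))) ℂ)) ψ).re -
        densityStructureFactor L 0 ψ := by
  rw [← sum_univ_densityStructureFactor_eq_density_docc, sum_univ_densityStructureFactor]
  exact sum_densityStructureFactor_le_of_zero_not_mem L K hK ψ

/-! ### `N`-particle vectors: `𝒩 = N ‖ψ‖²` and the Bragg peak `S_c(0; ψ) = N² ‖ψ‖² / L²` -/

/-- `Σ_x n_x` over the torus sites is the total number operator. -/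
theorem sum_siteDensity_eq_totalNumber :
    ∑ x : TorusSite 2 L, siteDensity (ofTorusSite x) =
      (totalNumber : Matrix (Finset (Orb (FermionTorus 2 L))) (Finset (Orb (FermionTorus 2 L))) ℂ) := by
  rw [totalNumber]
  rw [← Equiv.sum_comp (FermionTorus.equivTorusSite (d := 2) (L := L)).symm]
  refine Fintype.sum_congr _ _ fun x => ?_
  rw [siteDensity_def, Fin.sum_univ_two]
  rfl

/-- `𝒩 = Re ⟨ψ, Σ_x n_x ψ⟩ = N · ‖ψ‖²` on an `N`-particle vector. -/
theorem re_expect_sum_siteDensity_of_isNParticle {N : ℕ} {ψ : Fock (Orb (FermionTorus 2 L))}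
    (hψ : IsNParticle N ψ) :
    (expect (∑ x : TorusSite 2 L, siteDensity (ofTorusSite x)) ψ).re = N * (star ψ ⬝ᵥ ψ).re := by
  rw [sum_siteDensity_eq_totalNumber, expect, totalNumber_mulVec_of_isNParticle hψ, dotProduct_smul,
    smul_eq_mul]
  have : ((N : ℂ)) = ((N : ℝ) : ℂ) := by push_cast; rfl
  rw [this, Complex.re_ofReal_mul]

/-- `𝓢_c(0) = N̂²` (all Bloch phases are `1` at `k = 0`). -/
theorem densityStructureOp_zero :
    densityStructureOp L 0 =
      (totalNumber : Matrix (Finset (Orb (FermionTorus 2 L))) (Finset (Orb (FermionTorus 2 L))) ℂ) *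
        totalNumber := by
  have h1 : ∀ x : TorusSite 2 L, blochPhase L 0 x = 1 := fun x => by
    have : torusDot L 0 x = 0 := by simp [torusDot]
    rw [blochPhase, this, AddChar.map_zero_eq_one]
  simp only [densityStructureOp, h1, star_one, mul_one, one_smul]
  rw [← sum_siteDensity_eq_totalNumber, Finset.sum_mul_sum]

/-- **Bragg peak: `S_c(0; ψ) = N² ‖ψ‖² / L²`** on an `N`-particle vector. -/
theorem densityStructureFactor_zero_of_isNParticle {N : ℕ} {ψ : Fock (Orb (FermionTorus 2 L))}
    (hψ : IsNParticle N ψ) :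
    densityStructureFactor L 0 ψ = (N : ℝ) ^ 2 * (star ψ ⬝ᵥ ψ).re / (L : ℝ) ^ 2 := by
  unfold densityStructureFactor
  rw [densityStructureOp_zero, expect, ← mulVec_mulVec, totalNumber_mulVec_of_isNParticle hψ,
    mulVec_smul, totalNumber_mulVec_of_isNParticle hψ, smul_smul, dotProduct_smul, smul_eq_mul]
  have : ((N : ℂ) * (N : ℂ)) = (((N : ℝ) ^ 2 : ℝ) : ℂ) := by push_cast; ring
  rw [this, Complex.re_ofReal_mul]

/-- **The certificate-free ceiling of stripe_defs §5bis, charge channel**: on a unit `N`-particle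
vector with total double occupancy `𝒟 = Re ⟨ψ, Σ_x n_{x↑}n_{x↓} ψ⟩`, for every set `K` of NON-ZERO
momenta, `Σ_{k ∈ K} S_c(k; ψ) ≤ N + 2𝒟 − N²/L²`. -/
theorem sum_densityStructureFactor_le_of_isNParticle {N : ℕ} {ψ : Fock (Orb (FermionTorus 2 L))}
    (hψ : IsNParticle N ψ) (hnorm : star ψ ⬝ᵥ ψ = 1) (K : Finset (TorusSite 2 L))
    (hK : (0 : TorusSite 2 L) ∉ K) :
    ∑ k ∈ K, densityStructureFactor L k ψ ≤
      (N : ℝ) + 2 * (expect (∑ x : TorusSite 2 L, (numberOp (ofTorusSite x) 0 * numberOp (ofTorusSite x) 1 :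
          Matrix (Finset (Orb (FermionTorus 2 L))) (Finset (Orb (FermionTorus 2 L))) ℂ)) ψ).re -
        (N : ℝ) ^ 2 / (L : ℝ) ^ 2 := by
  have h := sum_densityStructureFactor_le_density_docc L K hK ψ
  rw [re_expect_sum_siteDensity_of_isNParticle L hψ, densityStructureFactor_zero_of_isNParticle L hψ,
    hnorm] at h
  simpa using h

/-- **The certificate-free ceiling of stripe_defs §5bis, spin channel**: on a unit `N`-particle
vector, for every set `K` of momenta, `Σ_{k ∈ K} S_s(k; ψ) ≤ (3/4)(N − 2𝒟)`. -/
theorem sum_spinStructureFactor_le_of_isNParticle {N : ℕ} {ψ : Fock (Orb (FermionTorus 2 L))}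
    (hψ : IsNParticle N ψ) (hnorm : star ψ ⬝ᵥ ψ = 1) (K : Finset (TorusSite 2 L)) :
    ∑ k ∈ K, spinStructureFactor L k ψ ≤
      (3 / 4 : ℝ) * ((N : ℝ) - 2 * (expect (∑ x : TorusSite 2 L, (numberOp (ofTorusSite x) 0 * numberOp (ofTorusSite x) 1 :
          Matrix (Finset (Orb (FermionTorus 2 L))) (Finset (Orb (FermionTorus 2 L))) ℂ)) ψ).re) := by
  have h := sum_spinStructureFactor_le_density_docc L K ψ
  rw [re_expect_sum_siteDensity_of_isNParticle L hψ, hnorm] at h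
  simpa using h

end SumRule

end Summit.Ventures.CertifiedManyBodySolver.Observables

end
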